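import Mathlib
import Literature.Analysis.FluidPDE.Tao2016AveragedNS.ShiftSetCascadeFlows
import Literature.Analysis.FluidPDE.Tao2016AveragedNS.ShiftSetCascadeFlux
import Summits.NavierStokesRegularity.NavierStokesRegularity.Theorems.TaoLadderRungTwoFlatCertificateGlueCheckerBranchGenOn
import Summits.NavierStokesRegularity.NavierStokesRegularity.Theorems.TaoLadderRungTwoFlatCertificateGlueCheckerLandOn
import HarnessLib

/-!
# Certificate glue on a shift set `𝕊`, XXXIII-c / XXXIV-b / XXXV-b: READOUT AND LANDING OVER A GENERIC COEFFICIENT-BOX TABLE — glue XXXIII-b `stepRead_of_checksV`,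
  XXXIV `stepRead_readout_of_checks` and XXXV `hland_of_chainChecksV` with `coefBoxOf prec αq ωq Sp Sm` replaced by any table `cB` with `CoefBoxOK`
  (helper for items stmt-NavierStokesRegularity-22987 `FlatGapCertificatesV2` (crux K_A♭ of route TaoLadderRungTwoFlat) and stmt-24295 K_A₂(64);
  cell harvest/h2-tao-ladder, p1 g16; PERFORMANCE refactor)

HONEST FRAMING: Tao-type MODEL lattices (Tao 2016 §4/§6 vocabulary, shift-set parametrised); checker soundness — NO certificate instance exists in the
tree, nothing is certified here, no stub is closed, nothing here is a statement about the Navier–Stokes equations.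
-/

-- the sub-problem namespace repeats the summit name by design (D-0017)
set_option linter.dupNamespace false

namespace Summit.NavierStokesRegularity.NavierStokesRegularity.Theorems

open Set Finset Literature.Analysis.FluidPDE Literature.Analysis.FluidPDE.TaoCascade
open Summit.NavierStokesRegularity.NavierStokesRegularity.Theorems.TaylorModelCert

namespace CertificateGlueOn

variable {m : ℕ} {𝕊 : Finset (ℤ × ℤ × ℤ)} {ε₀ : ℝ} {α : Fin m → Fin m → Fin m → ℤ × ℤ × ℤ → ℝ} {Kb Ka : ℤ}
  {Eb Et : ℝ} {M : ℤ → ℝ}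

/-- **`StepRead` INTO THE SECTION-NODE BOX FROM THE BOOLEANS, VECTOR LAYOUT**: `checkGlobal`, `checkStepV … j` (glue XXIX-c) and `checkSection`
(glue XXXIII, against the record's box and input defect) ⇒ every run from `nodeOfV rec j` of length `≤ h j`, read where `sec_q(pxcoord y) = lev`, has
`|pxcoord y − x*|_c ≤ Σ_col |C*_{c,col}| r_col + E*_c` with `E*` built from the remainder VECTOR `(rec j).E`.
[cite: Zgliczynski2002C1Lohner, §3–4 (Lohner-type parallelepiped sets; section maps); cell certificate format, section checker, vector remainder] -/
theorem stepRead_of_checksG (hKb : 0 ≤ Kb) (hKa : 1 ≤ Ka) {shifts : List (ℤ × ℤ × ℤ)} (hnd : shifts.Nodup)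
    (h𝕊 : IsNearestNeighbourSet shifts.toFinset) {q : ℚ}
    {αq : Fin m → Fin m → Fin m → ℤ × ℤ × ℤ → ℚ} {ωq : Fin m → ℤ → ℚ} (hω : ∀ i k, 0 < ωq i k)
    {cB : Fin m → ℤ → Fin m → Fin m → ℤ × ℤ × ℤ → IntervalD}
    (hcoef : CoefBoxOK shifts (q : ℝ) (fun i₁ i₂ i μ => (αq i₁ i₂ i μ : ℝ)) Kb Ka (fun i k => (ωq i k : ℝ)) cB)
    {prec p kexp nexp : ℕ} {Sp Sm : IntervalD} {bD : Dyad} {Eb Et lev : ℚ} {M : ℤ → ℝ} {rec : ℕ → VRec}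
    {qz : Array ℤ} {sr : SecRec} {j : ℕ}
    (hg : checkGlobalG m Kb Ka prec shifts cB q Sp Sm bD = true)
    (hs : checkStepG m Kb Ka prec p kexp nexp shifts cB αq ωq Sp Sm bD Eb Et rec j = true)
    (hsec : checkSection m Kb Ka prec shifts (cB) qz (rec j).lo (rec j).hi (rec j).δ sr = true) :
    let n := m * winLen Kb Ka
    let ω : Fin m → ℤ → ℝ := fun i k => (ωq i k : ℝ)
    StepRead shifts.toFinset (q : ℝ) (fun i₁ i₂ i μ => (αq i₁ i₂ i μ : ℝ)) Kb Ka (Eb : ℝ) (Et : ℝ) M (tOfV rec) (nodeOfV Kb Ka ωq rec)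
      (fun y => secQ (qvec (n := n) qz) (pxcoord Kb Ka ω y) = (lev : ℝ) →
        ∀ c, |pxcoord Kb Ka ω y c - secCentre (qvec (n := n) qz) (dvec (n := n) sr.p) (dvec (n := n) sr.f)
            (dvec (n := n) (rec j).x) (lev : ℝ) c| ≤
          ∑ col, |secFrame (qvec (n := n) qz) (dvec (n := n) sr.p) (dvec (n := n) sr.f) (dmat (n := n) (rec j).C) c col| *
              dvec (n := n) (rec j).r col +
            secErr (qvec (n := n) qz) (dvec (n := n) sr.p) (dvec (n := n) sr.κ) (dvec (n := n) (rec j).E) (dvec (n := n) sr.Φ)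
              ((rec j).h : ℝ) (secQmax (qvec (n := n) qz) (dvec (n := n) sr.W)) c) j := by
  intro n ω
  have hg' := hg
  simp only [checkGlobalG, Bool.and_eq_true, decide_eq_true_eq, Dyad.ble_iff, Dyad.toReal_ofInt, Int.cast_zero] at hg'
  obtain ⟨⟨⟨⟨hSp, hSm⟩, hq⟩, -⟩, -⟩ := hg'
  have hs' := hs
  simp only [checkStepG, Bool.and_eq_true, decide_eq_true_eq, Dyad.ble_iff, Dyad.toReal_ofInt, Int.cast_zero] at hs'
  obtain ⟨⟨⟨⟨⟨⟨⟨⟨⟨⟨⟨⟨⟨⟨-, -⟩, hAA'⟩, -⟩, -⟩, -⟩, -⟩, -⟩, -⟩, -⟩, -⟩, h13⟩, -⟩, h11⟩, -⟩ := hs'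
  have hq' : 0 < 1 + (q : ℝ) := by
    have : ((-1 : ℚ) : ℝ) < (q : ℝ) := by exact_mod_cast hq
    push_cast at this; linarith
  have hω' : ∀ i k, (0 : ℝ) < ω i k := fun i k => show (0 : ℝ) < (ωq i k : ℝ) by exact_mod_cast hω i k
  have hstep := stepCert_of_checkStepG (M := M) hKb hKa hnd h𝕊 hω hcoef hg hs
  have hdef := pinputDefect_of_checkDefectT prec hnd h𝕊 hq' hω hSp hSm h11
  have hrange := fieldRangeOn_of_pqBox (Eb := (Eb : ℝ)) (Et := (Et : ℝ)) hKb hKa hω' hnd hcoef prec hdef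
  obtain ⟨hd, hκ, hF, hΦ, hW⟩ := section_hyps_of_check (prec := prec) (shifts := shifts) (coefB := cB) hKb hKa hω hsec
  exact stepRead_of_sectionNodeV hKb hKa hω' hstep (fun y hy => hy) (fun y hy => inBox_of_hullOfG hnd hω hAA'.le h13 hy) hrange
    (tOfV_succ_sub rec j).le hd hκ hF hΦ hW

/-- **`StepRead` WITH THE READOUT CLAUSE FROM THE BOOLEANS**: `checkGlobal`, `checkStepV … j`, `checkSection` and `checkReadout` on the tabulated
section-node box ⇒ `StepRead` with exactly the readout property `hread` of glue XXXI `hland_of_branchMeshes'` (`sec y := secQ q (pxcoord y)`,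
`w := wq`, `ε₀ := q`, `θ₀ := θn/θd`), given `Core (zstate zc)`. [cite: Tao2016AveragedNS, §6.3–6.4 Props. 6.4–6.5 (statement shape; the readout clauses); cell certificate format, readout checker] -/
theorem stepRead_readout_of_checksG (hKb : 0 ≤ Kb) (hKa : 1 ≤ Ka) {shifts : List (ℤ × ℤ × ℤ)} (hnd : shifts.Nodup)
    (h𝕊 : IsNearestNeighbourSet shifts.toFinset) {q : ℚ} (hq : 0 < 1 + (q : ℝ))
    {αq : Fin m → Fin m → Fin m → ℤ × ℤ × ℤ → ℚ} {ωq : Fin m → ℤ → ℚ} (hω : ∀ i k, 0 < ωq i k)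
    {cB : Fin m → ℤ → Fin m → Fin m → ℤ × ℤ × ℤ → IntervalD}
    (hcoef : CoefBoxOK shifts (q : ℝ) (fun i₁ i₂ i μ => (αq i₁ i₂ i μ : ℝ)) Kb Ka (fun i k => (ωq i k : ℝ)) cB)
    {prec p kexp nexp : ℕ} {Sp Sm : IntervalD} {bD : Dyad} {Eb Et lev : ℚ} {M : ℤ → ℝ} {rec : ℕ → VRec}
    {qz : Array ℤ} {sr : SecRec} {j : ℕ} {Core : (Fin m → ℤ → ℝ) → Prop}
    {i₀ : Fin m} {σ a ρ r Zx Et' : ℚ} {θn θd : ℕ} {wq : ℤ → ℚ} {zc : Array Dyad}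
    (hg : checkGlobalG m Kb Ka prec shifts cB q Sp Sm bD = true)
    (hs : checkStepG m Kb Ka prec p kexp nexp shifts cB αq ωq Sp Sm bD Eb Et rec j = true)
    (hsec : checkSection m Kb Ka prec shifts (cB) qz (rec j).lo (rec j).hi (rec j).δ sr = true)
    (hread : checkReadout m Kb Ka ωq i₀ q σ a ρ r Zx Et' θn θd wq zc (xsArr (m * winLen Kb Ka) qz sr (rec j).x lev)
      (rsArr (m * winLen Kb Ka) qz sr (rec j).E (rec j).r (rec j).C (rec j).h) = true)
    (hcore : Core (zstate (m := m) Kb Ka zc)) :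
    StepRead shifts.toFinset (q : ℝ) (fun i₁ i₂ i μ => (αq i₁ i₂ i μ : ℝ)) Kb Ka (Eb : ℝ) (Et : ℝ) M (tOfV rec) (nodeOfV Kb Ka ωq rec)
      (fun y => secQ (qvec (n := m * winLen Kb Ka) qz) (pxcoord Kb Ka (fun i k => (ωq i k : ℝ)) y) = (lev : ℝ) →
        ∃ (a' : ℝ) (z' : Fin m → ℤ → ℝ), 0 < a' ∧ (1 + (q : ℝ)) ^ (-((θn : ℝ) / (θd : ℝ))) ≤ a' ∧
          (1 + (σ : ℝ)) * a' ≤ |y i₀ 1| ∧ Core z' ∧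
          (∀ i k, -Kb ≤ k → k + 1 ≤ Ka → (wq k : ℝ) * |y i (1 + k) / a' - z' i k| ≤ (ρ : ℝ) * (r : ℝ)) ∧
          (∀ (i : Fin m) (v : ℝ), |v| ≤ (Et' : ℝ) → (wq Ka : ℝ) * |v / a' - z' i Ka| ≤ (ρ : ℝ) * (r : ℝ)) ∧
          (∀ i, |y i (-Kb)| ≤ a' * (Zx : ℝ))) j := by
  have hSR := stepRead_of_checksG (M := M) (lev := lev) hKb hKa hnd h𝕊 hω hcoef hg hs hsec
  refine stepRead_mono hSR fun y hP hlev => ?_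
  have hbox := hP hlev
  refine read_of_checkReadout hKb hKa hω hq hread hcore fun c => ?_
  have h1 := hbox c
  have hX : ((xsArr (m * winLen Kb Ka) qz sr (rec j).x lev).getD c 0 : ℝ) =
      secCentre (qvec (n := m * winLen Kb Ka) qz) (dvec (n := m * winLen Kb Ka) sr.p) (dvec (n := m * winLen Kb Ka) sr.f)
        (dvec (n := m * winLen Kb Ka) (rec j).x) (lev : ℝ) c := by
    unfold xsArr; rw [getD_ofFn, cast_xsQ]
  have hR : ((rsArr (m * winLen Kb Ka) qz sr (rec j).E (rec j).r (rec j).C (rec j).h).getD c 0 : ℝ) =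
      ∑ col, |secFrame (qvec (n := m * winLen Kb Ka) qz) (dvec (n := m * winLen Kb Ka) sr.p) (dvec (n := m * winLen Kb Ka) sr.f)
          (dmat (n := m * winLen Kb Ka) (rec j).C) c col| * dvec (n := m * winLen Kb Ka) (rec j).r col +
        secErr (qvec (n := m * winLen Kb Ka) qz) (dvec (n := m * winLen Kb Ka) sr.p) (dvec (n := m * winLen Kb Ka) sr.κ)
          (dvec (n := m * winLen Kb Ka) (rec j).E) (dvec (n := m * winLen Kb Ka) sr.Φ) ((rec j).h : ℝ)
          (secQmax (qvec (n := m * winLen Kb Ka) qz) (dvec (n := m * winLen Kb Ka) sr.W)) c := by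
    unfold rsArr
    rw [getD_ofFn, ← cast_rsQ]
    congr 1
    refine congrArg (fun g => rsQ (m * winLen Kb Ka) qz sr.p sr.f sr.κ (rec j).E sr.Φ sr.W (rec j).r (rec j).C g (rec j).h c) ?_
    funext col
    exact getD_ofFn _ col
  rw [hX, hR]
  exact h1

/-! ### The landing clause from checked branch chains -/

variable {ι : Type*} {Core : (Fin m → ℤ → ℝ) → Prop} {w : ℤ → ℚ} {r : ℚ}

/-- **THE LANDING CLAUSE `hland` FROM CHECKED LAYOUT-V BRANCH CHAINS.** Per branch `b`: records `rec b` with `checkStepV` for `j ≤ j₂ b`, readout steps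
`j₁ b ≤ j ≤ j₂ b` each with a section record (`checkSection`) and readout constants (`checkReadout` on the tabulated section-node box), the sign tests
`checkSecBelow` at node `j₁ b` and `checkSecAbove` at node `j₂ b + 1`, the clocks `0 < Σ_{j<j₁} h` and `Σ_{j ≤ j₂} h ≤ c₀`, the identity start frame with a
nonnegative remainder vector; globally `checkGlobal`; `Core (zstate zc)` for every readout reference state; and the fattened core covered by the weighted start
boxes ⇒ the clause `hland` of glue IV verbatim (`sec := secQ q ∘ pxcoord`, `w := wq`, `θ₀ := θn/θd`).
[cite: Tao2016AveragedNS, §6.3–6.4 Props. 6.4–6.5 (statement shape of a renormalisation certificate; the readout at the crossing); cell certificate format, landing checker] -/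
theorem hland_of_chainChecksG (hKb : 0 ≤ Kb) (hKa : 1 ≤ Ka) {shifts : List (ℤ × ℤ × ℤ)} (hnd : shifts.Nodup)
    (h𝕊 : IsNearestNeighbourSet shifts.toFinset) {q : ℚ} (hq : 0 < 1 + (q : ℝ))
    {αq : Fin m → Fin m → Fin m → ℤ × ℤ × ℤ → ℚ} {ωq : Fin m → ℤ → ℚ} (hω : ∀ i k, 0 < ωq i k)
    {cB : Fin m → ℤ → Fin m → Fin m → ℤ × ℤ × ℤ → IntervalD}
    (hcoef : CoefBoxOK shifts (q : ℝ) (fun i₁ i₂ i μ => (αq i₁ i₂ i μ : ℝ)) Kb Ka (fun i k => (ωq i k : ℝ)) cB)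
    {prec p kexp nexp : ℕ} {Sp Sm : IntervalD} {bD : Dyad} {Eb Et lev c₀ : ℚ} {Mq : ℤ → ℚ}
    {rec : ι → ℕ → VRec} {j₁ j₂ : ι → ℕ} {sr : ι → ℕ → SecRec} {qz : Array ℤ}
    {i₀ : Fin m} {σ ρ Zx : ℚ} {θn θd : ℕ} {a : ι → ℕ → ℚ} {zc : ι → ℕ → Array Dyad}
    (hg : checkGlobalG m Kb Ka prec shifts cB q Sp Sm bD = true)
    (hj : ∀ b, j₁ b ≤ j₂ b)
    (hs : ∀ b j, j < j₂ b + 1 → checkStepG m Kb Ka prec p kexp nexp shifts cB αq ωq Sp Sm bD Eb Et (rec b) j = true)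
    (hsec : ∀ b j, j₁ b ≤ j → j ≤ j₂ b →
      checkSection m Kb Ka prec shifts (cB) qz (rec b j).lo (rec b j).hi (rec b j).δ (sr b j) = true)
    (hread : ∀ b j, j₁ b ≤ j → j ≤ j₂ b →
      checkReadout m Kb Ka ωq i₀ q σ (a b j) ρ r Zx Et θn θd w (zc b j) (xsArr (m * winLen Kb Ka) qz (sr b j) (rec b j).x lev)
        (rsArr (m * winLen Kb Ka) qz (sr b j) (rec b j).E (rec b j).r (rec b j).C (rec b j).h) = true)
    (hcore : ∀ b j, j₁ b ≤ j → j ≤ j₂ b → Core (zstate (m := m) Kb Ka (zc b j)))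
    (hbefore : ∀ b, checkSecBelow (m * winLen Kb Ka) qz (rec b (j₁ b)) lev = true)
    (hafter : ∀ b, checkSecAbove (m * winLen Kb Ka) qz (rec b (j₂ b + 1)) lev = true)
    (hpos : ∀ b, 0 < sumHV (rec b) (j₁ b)) (hc₀ : ∀ b, sumHV (rec b) (j₂ b + 1) ≤ c₀)
    (hid : ∀ b, checkIdFrame (m * winLen Kb Ka) (rec b 0).C = true) (hE : ∀ b, checkNonneg (m * winLen Kb Ka) (rec b 0).E = true)
    (hcover : ∀ (z S₀ : Fin m → ℤ → ℝ), Core z → (∀ i k, -Kb ≤ k → k ≤ Ka → (w k : ℝ) * |S₀ i k - z i k| ≤ (r : ℝ)) →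
      ∃ b, ∀ d, |pxcoord Kb Ka (fun i k => (ωq i k : ℝ)) S₀ d - dvec (n := m * winLen Kb Ka) (rec b 0).x d| ≤
        dvec (n := m * winLen Kb Ka) (rec b 0).r d) :
    ∀ (z : Fin m → ℤ → ℝ) (S : Fin m → ℤ → ℝ → ℝ), Core z →
      (∀ i k, -Kb ≤ k → k ≤ Ka → (w k : ℝ) * |S i k 0 - z i k| ≤ (r : ℝ)) →
      (∀ i k, -Kb ≤ k → k ≤ Ka → ∀ u ∈ Icc 0 (c₀ : ℝ),
        HasDerivWithinAt (S i k) (quadTermOn shifts.toFinset (q : ℝ) (fun i₁ i₂ i μ => (αq i₁ i₂ i μ : ℝ)) S i k u) (Icc 0 (c₀ : ℝ)) u) →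
      (∀ i, ContinuousOn (S i (-Kb - 1)) (Icc 0 (c₀ : ℝ))) → (∀ i, ContinuousOn (S i (Ka + 1)) (Icc 0 (c₀ : ℝ))) →
      (∀ i, ∀ u ∈ Icc 0 (c₀ : ℝ), |S i (-Kb - 1) u| ≤ (Eb : ℝ)) →
      (∀ i, ∀ u ∈ Icc 0 (c₀ : ℝ), |S i (Ka + 1) u| ≤ (Et : ℝ)) →
      (∀ i k, -Kb ≤ k → k ≤ Ka → ∀ u ∈ Icc 0 (c₀ : ℝ), |S i k u| ≤ (Mq k : ℝ)) →
        ∃ (τ₁ a' : ℝ) (z' : Fin m → ℤ → ℝ), 0 < τ₁ ∧ τ₁ ≤ (c₀ : ℝ) ∧ 0 < a' ∧ (1 + (q : ℝ)) ^ (-((θn : ℝ) / (θd : ℝ))) ≤ a' ∧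
          (1 + (σ : ℝ)) * a' ≤ |S i₀ 1 τ₁| ∧ Core z' ∧
          (∀ i k, -Kb ≤ k → k + 1 ≤ Ka → (w k : ℝ) * |S i (1 + k) τ₁ / a' - z' i k| ≤ (ρ : ℝ) * (r : ℝ)) ∧
          (∀ (i : Fin m) (v : ℝ), |v| ≤ (Et : ℝ) → (w Ka : ℝ) * |v / a' - z' i Ka| ≤ (ρ : ℝ) * (r : ℝ)) ∧
          (∀ i, |S i (-Kb) τ₁| ≤ a' * (Zx : ℝ)) := by
  have hstep : ∀ b j, j < j₂ b + 1 → StepCert shifts.toFinset (q : ℝ) (fun i₁ i₂ i μ => (αq i₁ i₂ i μ : ℝ)) Kb Ka (Eb : ℝ) (Et : ℝ)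
      (fun k => (Mq k : ℝ)) (tOfV (rec b)) (nodeOfV Kb Ka ωq (rec b)) (hullOfG Kb Ka shifts cB ωq (rec b)) j :=
    fun b j hjb => stepCert_of_checkStepG hKb hKa hnd h𝕊 hω hcoef hg (hs b j hjb)
  have hmono : ∀ b j, j < j₂ b + 1 → tOfV (rec b) j < tOfV (rec b) (j + 1) := by
    intro b j hjb
    have h := hs b j hjb
    simp only [checkStepG, Bool.and_eq_true, decide_eq_true_eq] at h
    exact tOfV_lt_succ h.1.1.1.1.1.1.1.1.1.1.1.2
  have hpos' : ∀ b, 0 < tOfV (rec b) (j₁ b) := fun b => by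
    have : ((0 : ℚ) : ℝ) < ((sumHV (rec b) (j₁ b) : ℚ) : ℝ) := by exact_mod_cast hpos b
    have e : tOfV (rec b) (j₁ b) = ((sumHV (rec b) (j₁ b) : ℚ) : ℝ) := by simp [tOfV, sumHV]
    rw [e]; simpa using this
  have hc₀' : ∀ b, tOfV (rec b) (j₂ b + 1) ≤ (c₀ : ℝ) := fun b => by
    have e : tOfV (rec b) (j₂ b + 1) = ((sumHV (rec b) (j₂ b + 1) : ℚ) : ℝ) := by simp [tOfV, sumHV]
    rw [e]; exact_mod_cast hc₀ b
  have hread' : ∀ b j, j₁ b ≤ j → j ≤ j₂ b → StepRead shifts.toFinset (q : ℝ) (fun i₁ i₂ i μ => (αq i₁ i₂ i μ : ℝ)) Kb Ka (Eb : ℝ) (Et : ℝ)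
      (fun k => (Mq k : ℝ)) (tOfV (rec b)) (nodeOfV Kb Ka ωq (rec b))
      (fun y => secQ (qvec (n := m * winLen Kb Ka) qz) (pxcoord Kb Ka (fun i k => (ωq i k : ℝ)) y) = (lev : ℝ) →
        ∃ (a' : ℝ) (z' : Fin m → ℤ → ℝ), 0 < a' ∧ (1 + (q : ℝ)) ^ (-((θn : ℝ) / (θd : ℝ))) ≤ a' ∧
          (1 + (σ : ℝ)) * a' ≤ |y i₀ 1| ∧ Core z' ∧
          (∀ i k, -Kb ≤ k → k + 1 ≤ Ka → (w k : ℝ) * |y i (1 + k) / a' - z' i k| ≤ (ρ : ℝ) * (r : ℝ)) ∧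
          (∀ (i : Fin m) (v : ℝ), |v| ≤ (Et : ℝ) → (w Ka : ℝ) * |v / a' - z' i Ka| ≤ (ρ : ℝ) * (r : ℝ)) ∧
          (∀ i, |y i (-Kb)| ≤ a' * (Zx : ℝ))) j :=
    fun b j hj1 hj2 => stepRead_readout_of_checksG hKb hKa hnd h𝕊 hq hω hcoef hg (hs b j (by omega)) (hsec b j hj1 hj2) (hread b j hj1 hj2)
      (hcore b j hj1 hj2)
  have key := hland_of_branchMeshes' (𝕊 := shifts.toFinset) (ε₀ := (q : ℝ)) (α := fun i₁ i₂ i μ => (αq i₁ i₂ i μ : ℝ)) (Kb := Kb) (Ka := Ka)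
    (Eb := (Eb : ℝ)) (Et := (Et : ℝ)) (M := fun k => (Mq k : ℝ)) (Core := Core) (w := fun k => (w k : ℝ)) (r := (r : ℝ))
    (Box := fun b S₀ => ∀ d, |pxcoord Kb Ka (fun i k => (ωq i k : ℝ)) S₀ d - dvec (n := m * winLen Kb Ka) (rec b 0).x d| ≤
      dvec (n := m * winLen Kb Ka) (rec b 0).r d)
    (t := fun b => tOfV (rec b)) (Node := fun b => nodeOfV Kb Ka ωq (rec b))
    (Hull := fun b => hullOfG Kb Ka shifts cB ωq (rec b)) (ρ := (ρ : ℝ)) (θ₀ := (θn : ℝ) / (θd : ℝ)) (σ := (σ : ℝ))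
    (c₀ := (c₀ : ℝ)) (Zx := (Zx : ℝ)) (i₀ := i₀)
    (sec := fun y => secQ (qvec (n := m * winLen Kb Ka) qz) (pxcoord Kb Ka (fun i k => (ωq i k : ℝ)) y)) (lev := (lev : ℝ))
    (j₁ := j₁) (j₂ := j₂) hcover hj (fun b => tOfV_zero (rec b)) hmono hpos' hc₀'
    (fun b y hy => node0_of_boxV (hid b) (hE b) hy) hstep
    (fun s S hrun => continuousOn_secQ_of_windowRun hKb hKa _ _ hrun)
    (fun b y hy => sec_lt_of_checkSecBelow (hbefore b) hy) (fun b y hy => le_sec_of_checkSecAbove (hafter b) hy) hread'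
  exact key

end CertificateGlueOn

end Summit.NavierStokesRegularity.NavierStokesRegularity.Theorems
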